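import Summits.ResolutionOfSingularities.ResolutionOfSingularities.Theorems.FrobeniusClosingPatchingRelPerfectMonomialGameBridge
import HarnessLib

/-!
# Crux `PatchingRelPerfect` (stmt-ResolutionOfSingularities-16161), chain w52 — M2-strong, SCHEME DICTIONARY
# part 4: one game MOVE on the scheme side (the invariant `GameInv` at the moved state)

[OURS · L1 W5.2 · TargetsF3 (m) M2-strong, background line] Sequel of `…MonomialGameBridge.lean`
(invariant `GameInv`, win read-out).  PROVED: `labMove` (fresh index at the exceptional position),
**`agree_move`** (a transformed member agrees with the moved game vector at every pointed position — at
the exceptional position because `|α_J|` is the weight of the member on the divisor set of the positions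
of `J`, `weightOf_image_nthSheaf_eq_sum`), **`str_move`** (new position cliques label into
res-type-075's `moveStrata`: `not_forall_mem_support_transformBoundary`, `common_point_old_of_new`), and
**`gameInv_move`**: the invariant holds between `PolyhedraGame.move s J e 0` and the blown-up scheme datum
`(Bl, Es.map strict ++ [F], 𝒦.map (transformExp · π T 0), labMove)`.  The induction on `Winnable` and
the theorem «game ⇒ M2» are `…MonomialGamePrincipalization.lean`.  Fact-free; nothing here is a statement
of the manuscript under review.

## References

* J. Kollár, *Lectures on Resolution of Singularities* (2007), (3.111) Step 3. [Kollar2007]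
-/

-- `Summit.<Summit>.<Sub>.Theorems` with `Sub = Summit` (single-conjunct summit, D-0017)
set_option linter.dupNamespace false

noncomputable section

open CategoryTheory AlgebraicGeometry TopologicalSpace IsLocalRing
open Literature.AlgebraicGeometry.Resolution

namespace Summit.ResolutionOfSingularities.ResolutionOfSingularities.Theorems

namespace MonomialCleanup

open DepthTargets (monomialSum monomialSum_nil monomialSum_cons)
open PolyhedraGame (State Winnable Permissible Principal PrincipalAt moveExp moveStrata move weight
  GlobalPermissiblePolyhedraGame mem_moveStrata_iff moveExp_apply_of_ne moveExp_apply_self)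

universe u

/-! ## The step: the invariant at the moved state -/

section Move

variable {X X' : Scheme.{u}} [IsLocallyNoetherian X] {s : State} {Es : List X.IdealSheafData}
  {𝒦 : List (List (X.IdealSheafData × ℕ))} {lab : ℕ → ℕ} {J : Finset ℕ} {e : ℕ} {π : X' ⟶ X}

/-- The new labelling: the exceptional position `n` gets the fresh index `e`. [folklore] -/
def labMove (Es : List X.IdealSheafData) (lab : ℕ → ℕ) (e : ℕ) : ℕ → ℕ :=
  fun k => if k = Es.length then e else lab k

omit [IsLocallyNoetherian X] in
/-- The new labelling on old positions. [folklore] -/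
theorem labMove_lt {k : ℕ} (hk : k < Es.length) : labMove Es lab e k = lab k := by
  simp [labMove, Nat.ne_of_lt hk]

omit [IsLocallyNoetherian X] in
/-- The new labelling at the exceptional position. [folklore] -/
@[simp] theorem labMove_length : labMove Es lab e Es.length = e := by simp [labMove]

open Classical in
omit [IsLocallyNoetherian X] in
/-- **Agreement persists**: the transformed member `transformExp A π T 0` agrees with the moved game
vector `moveExp J e 0 α` at every pointed position of the transformed boundary — at the exceptional
position because `|α_J|` is the weight of `A` on the divisor set of the positions of `J`
(`weightOf_image_nthSheaf_eq_sum`). [cite: Kollar2007, (3.111) Step 3] -/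
theorem agree_move (hinv : GameInv s Es 𝒦 lab) (hJB : J ⊆ s.B) (he : e ∉ s.B)
    {A : List (X.IdealSheafData × ℕ)} {α : ℕ →₀ ℕ} (hA : A ∈ 𝒦) (hα : α ∈ s.A) (hagr : Agree Es lab A α) :
    Agree (Es.map (strictTransformIdeal π (((posOf Es lab J).image (nthSheaf Es)).sup id)) ++
        [(((posOf Es lab J).image (nthSheaf Es)).sup id).comap π])
      (labMove Es lab e) (transformExp A π ((posOf Es lab J).image (nthSheaf Es)) 0) (moveExp J e 0 α) := by
  set P := posOf Es lab J with hPdef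
  set T := P.image (nthSheaf Es) with hTdef
  have hPlt : ∀ k ∈ P, k < Es.length := fun k hk => (mem_posOf_iff.mp hk).1
  have hlenA : A.length = Es.length := hinv.length_eq hA
  intro k hk hptd
  have hlen' : (Es.map (strictTransformIdeal π (T.sup id)) ++ [(T.sup id).comap π]).length = Es.length + 1 := by
    simp
  rw [hlen'] at hk
  obtain ⟨x', hx'⟩ := hptd
  rcases Nat.lt_succ_iff_lt_or_eq.mp hk with hk | rfl
  · -- an old position
    have hne : lab k ≠ e := fun h => he (h ▸ hinv.lab_mem hk)
    rw [nthSheaf_transformBoundary_lt Es hk] at hx'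
    rw [labMove_lt hk, moveExp_apply_of_ne α hne, nthExp_transformExp_lt A (hlenA ▸ hk),
      hagr k hk ⟨π x', mem_support_of_mem_support_strictTransformIdeal hx'⟩]
  · -- the exceptional position
    rw [nthSheaf_transformBoundary_eq Es] at hx'
    have hx'' : x' ∈ (((T.sup id).comap π).support : Set X') := hx'
    rw [Scheme.IdealSheafData.support_comap] at hx''
    have hPx : ∀ k ∈ P, π x' ∈ (nthSheaf Es k).support := fun k hk =>
      (mem_support_finsetSup_iff T _).mp hx'' _ (Finset.mem_image_of_mem _ hk)
    have heα : e ∉ α.support := fun h => he (hinv.supp α hα e (Finsupp.mem_support_iff.mp h))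
    rw [labMove_length, moveExp_apply_self α heα, Nat.sub_zero, ← hlenA, nthExp_transformExp_eq A, Nat.sub_zero,
      weight_eq_sum_posOf hinv hJB]
    -- `Σ_{k∈P} α (lab k) = weightOf A T`
    have hPD : PointedDistinct (boundaryOf A) := (hinv.bd A hA).symm ▸ hinv.pd
    have hPltA : ∀ k ∈ P, k < A.length := fun k hk => hlenA ▸ hPlt k hk
    have hPxA : ∀ k ∈ P, π x' ∈ (nthSheaf (boundaryOf A) k).support := fun k hk => by
      rw [hinv.bd A hA]; exact hPx k hk
    have hw := weightOf_image_nthSheaf_eq_sum hPD hPltA hPxA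
    rw [hinv.bd A hA] at hw
    rw [← hPdef, hw]
    exact Finset.sum_congr rfl fun k hk => hagr k (hPlt k hk) ⟨π x', hPx k hk⟩

open Classical in
/-- **New cliques label into the moved stratum complex** (`moveStrata`): through the exceptional
position they are `insert e T₀` with `T₀`, `T₀ ∪ J` old strata and `J ⊄ T₀`; away from it they are
old strata not containing `J`. [cite: Kollar2007, (3.111) Step 3] -/
theorem str_move (hinv : GameInv s Es 𝒦 lab) (hJB : J ⊆ s.B)
    (hπ : IsBlowup π (((posOf Es lab J).image (nthSheaf Es)).sup id))
    (S' : Finset ℕ) (hS'lt : ∀ k ∈ S', k < Es.length + 1) {x' : X'}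
    (hx' : ∀ k ∈ S', x' ∈ (nthSheaf (Es.map (strictTransformIdeal π (((posOf Es lab J).image (nthSheaf Es)).sup id)) ++
        [(((posOf Es lab J).image (nthSheaf Es)).sup id).comap π]) k).support) :
    S'.image (labMove Es lab e) ∈ moveStrata s.Str J e := by
  set P := posOf Es lab J with hPdef
  set T := P.image (nthSheaf Es) with hTdef
  set Es' := Es.map (strictTransformIdeal π (T.sup id)) ++ [(T.sup id).comap π] with hEs'
  have hPlt : ∀ k ∈ P, k < Es.length := fun k hk => (mem_posOf_iff.mp hk).1
  have hold := common_point_old_of_new (Es := Es) (T := T) (π := π) (S' := S') (x' := x') hx'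
  -- the positions of `J` are never all passed through
  have hnotJ : ∀ S₀ : Finset ℕ, (∀ k ∈ S₀, k < Es.length) → (∀ k ∈ S₀, x' ∈ (nthSheaf Es' k).support) →
      ¬ J ⊆ S₀.image lab := by
    intro S₀ hS₀lt hS₀x hJS₀
    have hPS₀ : P ⊆ S₀ := by
      intro k hk
      have hkJ : lab k ∈ J := (mem_posOf_iff.mp hk).2
      obtain ⟨k', hk', hkk'⟩ := Finset.mem_image.mp (hJS₀ hkJ)
      rwa [← hinv.lab_inj k' k (hS₀lt k' hk') (hPlt k hk) hkk']
    exact not_forall_mem_support_transformBoundary hinv.snc hPlt hπ x' fun k hk => hS₀x k (hPS₀ hk)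
  by_cases hnS : Es.length ∈ S'
  · -- through the exceptional position
    set S₀ := S'.erase Es.length with hS₀
    have hS₀lt : ∀ k ∈ S₀, k < Es.length := fun k hk => by
      have h1 := Finset.mem_erase.mp hk
      have h2 := hS'lt k h1.2
      omega
    have hS₀x : ∀ k ∈ S₀, x' ∈ (nthSheaf Es' k).support := fun k hk => hx' k (Finset.mem_erase.mp hk).2
    have himg : S'.image (labMove Es lab e) = insert e (S₀.image lab) := by
      rw [← Finset.insert_erase hnS, Finset.image_insert, labMove_length]
      congr 1
      exact Finset.image_congr fun k hk => labMove_lt (hS₀lt k (Finset.mem_coe.mp hk))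
    rw [himg, mem_moveStrata_iff]
    refine Or.inr ⟨S₀.image lab, hinv.str S₀ hS₀lt ⟨π x', fun k hk => hold.1 k (Finset.mem_erase.mp hk).2 (hS₀lt k hk)⟩,
      hnotJ S₀ hS₀lt hS₀x, ?_, rfl⟩
    rw [← image_lab_posOf hinv hJB, ← Finset.image_union]
    refine hinv.str _ (fun k hk => ?_) ⟨π x', fun k hk => ?_⟩
    · rcases Finset.mem_union.mp hk with hk | hk
      · exact hS₀lt k hk
      · exact hPlt k hk
    · rcases Finset.mem_union.mp hk with hk | hk
      · exact hold.1 k (Finset.mem_erase.mp hk).2 (hS₀lt k hk)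
      · exact hold.2 hnS _ (Finset.mem_image_of_mem _ hk)
  · -- away from the exceptional position
    have hS'lt' : ∀ k ∈ S', k < Es.length := fun k hk => by
      have h := hS'lt k hk
      have : k ≠ Es.length := fun h' => hnS (h' ▸ hk)
      omega
    have himg : S'.image (labMove Es lab e) = S'.image lab :=
      Finset.image_congr fun k hk => labMove_lt (hS'lt' k (Finset.mem_coe.mp hk))
    rw [himg, mem_moveStrata_iff]
    exact Or.inl ⟨hinv.str S' hS'lt' ⟨π x', fun k hk => hold.1 k hk (hS'lt' k hk)⟩, hnotJ S' hS'lt' hx'⟩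

open Classical in
/-- **The invariant at the moved state.** [cite: Kollar2007, (3.111) Step 3] -/
theorem gameInv_move (hinv : GameInv s Es 𝒦 lab) (hJ : Permissible s J) (he : e ∉ s.B)
    (hπ : IsBlowup π (((posOf Es lab J).image (nthSheaf Es)).sup id)) :
    GameInv (move s J e 0)
      (Es.map (strictTransformIdeal π (((posOf Es lab J).image (nthSheaf Es)).sup id)) ++
        [(((posOf Es lab J).image (nthSheaf Es)).sup id).comap π])
      (𝒦.map fun A => transformExp A π ((posOf Es lab J).image (nthSheaf Es)) 0) (labMove Es lab e) := by
  set P := posOf Es lab J with hPdef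
  set T := P.image (nthSheaf Es) with hTdef
  have hJB : J ⊆ s.B := hinv.str_B J hJ.1
  have hPlt : ∀ k ∈ P, k < Es.length := fun k hk => (mem_posOf_iff.mp hk).1
  have hT : ∀ K ∈ T, K ∈ Es := image_nthSheaf_subset hPlt
  have hlen' : (Es.map (strictTransformIdeal π (T.sup id)) ++ [(T.sup id).comap π]).length = Es.length + 1 := by
    simp
  have hsnc : HasSNC (Es.map (strictTransformIdeal π (T.sup id)) ++ [(T.sup id).comap π]) :=
    (hinv.snc.hasSNCWith_finsetSup T hT).hasSNC_transform hπ
  have hbd : ∀ A' ∈ 𝒦.map (fun A => transformExp A π T 0),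
      boundaryOf A' = Es.map (strictTransformIdeal π (T.sup id)) ++ [(T.sup id).comap π] := by
    intro A' hA'
    obtain ⟨A, hA, rfl⟩ := List.mem_map.mp hA'
    rw [boundaryOf_transformExp, hinv.bd A hA]
  have hpd := hinv.pd.transformBoundary hinv.snc hT hπ
  have hlabinj : ∀ k k', k < Es.length + 1 → k' < Es.length + 1 →
      labMove Es lab e k = labMove Es lab e k' → k = k' := by
    intro k k' hk hk' h
    rcases Nat.lt_succ_iff_lt_or_eq.mp hk with hk | rfl
    · rcases Nat.lt_succ_iff_lt_or_eq.mp hk' with hk' | rfl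
      · rw [labMove_lt hk, labMove_lt hk'] at h; exact hinv.lab_inj k k' hk hk' h
      · rw [labMove_lt hk, labMove_length] at h
        exact absurd (h ▸ hinv.lab_mem hk) he
    · rcases Nat.lt_succ_iff_lt_or_eq.mp hk' with hk' | hk'
      · rw [labMove_length, labMove_lt hk'] at h
        exact absurd (h.symm ▸ hinv.lab_mem hk') he
      · exact hk'.symm
  have hBeq : (move s J e 0).B = (Finset.range (Es.length + 1)).image (labMove Es lab e) := by
    show insert e s.B = _
    rw [Finset.range_add_one, Finset.image_insert, labMove_length, hinv.B_eq]
    congr 1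
    exact Finset.image_congr fun k hk => (labMove_lt (Finset.mem_range.mp (Finset.mem_coe.mp hk))).symm
  have hstrB : ∀ T' ∈ (move s J e 0).Str, T' ⊆ (move s J e 0).B := by
    intro T' hT'
    show T' ⊆ insert e s.B
    rcases mem_moveStrata_iff.mp hT' with ⟨h1, -⟩ | ⟨T₀, h₀, -, -, rfl⟩
    · exact (hinv.str_B T' h1).trans (Finset.subset_insert _ _)
    · exact Finset.insert_subset_insert _ (hinv.str_B T₀ h₀)
  have hsupp : ∀ α' ∈ (move s J e 0).A, ∀ b, α' b ≠ 0 → b ∈ (move s J e 0).B := by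
    intro α' hα' b hb
    show b ∈ insert e s.B
    obtain ⟨α, hα, rfl⟩ := Finset.mem_image.mp hα'
    by_cases hbe : b = e
    · subst hbe; exact Finset.mem_insert_self _ _
    · rw [moveExp_apply_of_ne α hbe] at hb
      exact Finset.mem_insert_of_mem (hinv.supp α hα b hb)
  refine ⟨hsnc, hbd, hpd, fun k k' hk hk' => hlabinj k k' (hlen' ▸ hk) (hlen' ▸ hk'), hlen'.symm ▸ hBeq,
    hstrB, hsupp, fun S' hS'lt hS'pt => ?_, fun A' hA' => ?_, fun α' hα' => ?_⟩
  · obtain ⟨x', hx'⟩ := hS'pt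
    exact str_move hinv hJB hπ S' (fun k hk => hlen' ▸ hS'lt k hk) hx'
  · obtain ⟨A, hA, rfl⟩ := List.mem_map.mp hA'
    obtain ⟨α, hα, hagr⟩ := hinv.fwd A hA
    exact ⟨moveExp J e 0 α, Finset.mem_image_of_mem _ hα, agree_move hinv hJB he hA hα hagr⟩
  · obtain ⟨α, hα, rfl⟩ := Finset.mem_image.mp hα'
    obtain ⟨A, hA, hagr⟩ := hinv.bwd α hα
    exact ⟨transformExp A π T 0, List.mem_map.mpr ⟨A, hA, rfl⟩, agree_move hinv hJB he hA hα hagr⟩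

end Move

end MonomialCleanup

end Summit.ResolutionOfSingularities.ResolutionOfSingularities.Theorems

end
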